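import Mathlib.RingTheory.SimpleModule.Basic
import Mathlib.LinearAlgebra.Projection
import Mathlib.Algebra.BigOperators.Fin
import HarnessLib

/-!
# Graded modules with a degree-one endomorphism, I: strings and their splitting

This file is part of a small self-contained series (`GradedOrbitStrings`, `GradedOrbitRetract`,
`GradedOrbitReaching`, `GradedOrbitDegreewise`, `GradedOrbitConj`) proving the following
**conjugacy theorem** (`exists_graded_linearEquiv_conj`): let `R` be a ring containing a field
`K`, `M = ⨁_{k<N} gr k` a graded `R`-module, finite-dimensional over `K` and semisimple over
`R`, and `t`, `t'` two `R`-endomorphisms of degree `+1` which are *generic* — no non-zero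
`R`-endomorphism of degree `-1` commutes with them; then `t' = g t g⁻¹` for a degree-preserving
`R`-automorphism `g`.  For `R = K` this is the uniqueness of the rigid (= open-orbit)
representation of the equioriented quiver of type `A` with a given dimension vector; in the
language of Zelevinsky (*Induced representations of reductive 𝔭-adic groups II*, Ann. ÉNS 13
(1980), §§4, 8) it says that the multisegment with pairwise *unlinked* segments on a given
support is unique.  With `R = ℂ[W_K]` acting through a twisted Weil-group action it yields
A'Campo–Hevesi–Thorne–Whitmore, arXiv:2607.11763, Prop. 6.0.5 (2) (generic monodromy
operators on a fixed Frobenius-semisimple Weil representation form one orbit under the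
centraliser), see `Literature/NumberTheory/GaloisRepresentations/GenericWeilDeligneOrbitProofs`.

The proof is elementary and module-theoretic (no algebraic geometry, no Gabriel / Krull–Schmidt):
a *string* is `Z = ⨁_{r ≤ n} tʳ e(S)` for a simple `S` and `e : S → gr p`; a string born in a
degree `p` below which `S` does not occur splits off `t`-stably and compatibly with the grading
(`exists_isCompl_stringSum`); genericity passes to such summands; in a generic module the string
born at the bottom of a maximal interval of degrees occupied by `S` reaches its top
(`exists_comp_pow_ne_zero_of_occupied`); split off such longest strings for `t` and `t'`, cancel
the simple summands degreewise, and induct on `dim_K M`.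

Conventions.  Everything is stated without auxiliary definitions: a grading is a family
`gr : ℕ → Submodule R M` (with `iSupIndep gr`, `⨆ gr = ⊤` and `gr k = ⊥` for `k ≥ N` where
needed); "`t` has degree `+1`" is `∀ k, ∀ x ∈ gr k, t x ∈ gr (k + 1)`; a *string sum* is any
linear map `Ψ : (Fin (n+1) → S) →ₗ[R] M` with `Ψ s = ∑ r, t ^ (a + r) (e (s r))` (hypothesis
`hΨ`), so that lemmas apply to `∑ r, (t ^ r ∘ₗ e) ∘ₗ LinearMap.proj r` by `simp`.

## This file

* `pow_apply_mem_gr` — `t ^ j` has degree `+j`;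
* `stringSum_single`, `apply_stringSum_eq_stringSum_shift` — string sums of singles, and the
  shift formula `t (Ψ s) = Ψ (0, s₀, …, s_{n-1})` when `t^{a+n+1} e = 0`;
* `coord_eq_of_stringSum` — coordinates of a string are recovered by a retraction of its top;
* `exists_isCompl_stringSum` — **the splitting lemma**: a string born in a degree below which
  `S` does not occur has a `t`-stable complement, graded in the strong sense that every
  homogeneous `x` is `tʳ e s₀ + y` with `y` in the complement and homogeneous.

Mathlib has semisimple modules (`IsSemisimpleModule`, complements, `IsSimpleModule` and Schur
in the form `LinearMap.injective_or_eq_zero`), which is all that is used; it has no quiver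
representations.
-/

namespace Literature.RepresentationTheory.Semisimple

open Module

variable {R : Type*} [Ring R] {M : Type*} [AddCommGroup M] [Module R M]

/-- In an `ℕ`-graded module with an endomorphism `t` of degree `+1`, `t ^ j` has degree `+j`.
[folklore] -/
theorem pow_apply_mem_gr (gr : ℕ → Submodule R M) (t : M →ₗ[R] M)
    (ht : ∀ k, ∀ x ∈ gr k, t x ∈ gr (k + 1)) {k : ℕ} {x : M} (hx : x ∈ gr k) (j : ℕ) :
    (t ^ j) x ∈ gr (k + j) := by
  induction j with
  | zero => simpa using hx
  | succ j ih =>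
    rw [pow_succ', Module.End.mul_apply]
    exact ht _ _ ih

/-- A non-zero linear map out of a simple module is injective (Schur). [folklore] -/
theorem injective_of_comp_ne_zero {S : Type*} [AddCommGroup S] [Module R S] [IsSimpleModule R S]
    {e : S →ₗ[R] M} {u : M →ₗ[R] M} (h : u ∘ₗ e ≠ 0) : Function.Injective e := by
  refine LinearMap.injective_of_ne_zero fun he => h ?_
  rw [he, LinearMap.comp_zero]

/-- **String sums.**  For `e : S → M` of degree `p` and `t` of degree `+1`, the "string sum"
`Ψ s = ∑_{r ≤ n} tʳ e (s r)` of a single `Pi.single r s₀` is `tʳ e s₀`. [folklore] -/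
theorem stringSum_single {S : Type*} [AddCommGroup S] [Module R S] (t : M →ₗ[R] M)
    (e : S →ₗ[R] M) {n : ℕ} (a : ℕ) (Ψ : (Fin (n + 1) → S) →ₗ[R] M)
    (hΨ : ∀ s, Ψ s = ∑ r : Fin (n + 1), (t ^ (a + (r : ℕ))) (e (s r))) (r : Fin (n + 1))
    (s₀ : S) : Ψ (Pi.single r s₀) = (t ^ (a + (r : ℕ))) (e s₀) := by
  classical
  rw [hΨ, Finset.sum_eq_single r]
  · rw [Pi.single_eq_same]
  · intro r' _ hr'
    rw [Pi.single_eq_of_ne hr', map_zero, map_zero]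
  · intro h; exact absurd (Finset.mem_univ r) h

/-- String sums are homogeneous sums: the `r`-th term has degree `p + a + r`. [folklore] -/
theorem stringSum_term_mem_gr (gr : ℕ → Submodule R M) (t : M →ₗ[R] M)
    (ht : ∀ k, ∀ x ∈ gr k, t x ∈ gr (k + 1)) {S : Type*} [AddCommGroup S] [Module R S]
    (e : S →ₗ[R] M) {p : ℕ} (he : ∀ s, e s ∈ gr p) (a r : ℕ) (s₀ : S) :
    (t ^ (a + r)) (e s₀) ∈ gr (p + (a + r)) :=
  pow_apply_mem_gr gr t ht (he s₀) (a + r)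

/-- `t` shifts a string sum: `t (∑_{r ≤ n} t^{a+r} e (s r)) = ∑_{r ≤ n} t^{a+r} e (s' r)` with
`s' = (0, s 0, …, s (n-1))`, provided the string dies in time: `t^{a+n+1} ∘ e = 0`. [folklore] -/
theorem apply_stringSum_eq_stringSum_shift {S : Type*} [AddCommGroup S] [Module R S]
    (t : M →ₗ[R] M) (e : S →ₗ[R] M) {n : ℕ} (a : ℕ)
    (htop : (t ^ (a + (n + 1))) ∘ₗ e = 0) (Ψ : (Fin (n + 1) → S) →ₗ[R] M)
    (hΨ : ∀ s, Ψ s = ∑ r : Fin (n + 1), (t ^ (a + (r : ℕ))) (e (s r))) (s : Fin (n + 1) → S) :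
    t (Ψ s) = Ψ (Fin.cons 0 (Fin.init s)) := by
  rw [hΨ, hΨ, map_sum, Fin.sum_univ_castSucc, Fin.sum_univ_succ]
  simp only [Fin.cons_zero, map_zero, zero_add, Fin.cons_succ, Fin.val_castSucc, Fin.val_succ,
    Fin.val_last]
  have hlast : t ((t ^ (a + n)) (e (s (Fin.last n)))) = 0 := by
    rw [← Module.End.mul_apply, ← pow_succ', show a + n + 1 = a + (n + 1) by ring]
    exact congr($htop (s (Fin.last n)))
  rw [hlast, add_zero]
  refine Finset.sum_congr rfl fun r _ => ?_
  rw [← Module.End.mul_apply, ← pow_succ']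
  rfl

section Splitting

variable [IsSemisimpleModule R M]

omit [IsSemisimpleModule R M] in
/-- **Coordinate recovery for strings.**  If `λ : M → S` inverts `tⁿ e` and kills all degrees
other than `d = p + n`, then `λ (t^{n-r} (∑_{r'} t^{r'} e (s r'))) = s r`. [folklore] -/
theorem coord_eq_of_stringSum (gr : ℕ → Submodule R M) (t : M →ₗ[R] M)
    (ht : ∀ k, ∀ x ∈ gr k, t x ∈ gr (k + 1)) {S : Type*} [AddCommGroup S] [Module R S]
    (e : S →ₗ[R] M) {p n : ℕ} (he : ∀ s, e s ∈ gr p) (lam : M →ₗ[R] S)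
    (hlam1 : ∀ s, lam ((t ^ n) (e s)) = s)
    (hlam2 : ∀ k, k ≠ p + n → ∀ x ∈ gr k, lam x = 0)
    (Ψ : (Fin (n + 1) → S) →ₗ[R] M)
    (hΨ : ∀ s, Ψ s = ∑ r : Fin (n + 1), (t ^ (r : ℕ)) (e (s r))) (s : Fin (n + 1) → S)
    (r : Fin (n + 1)) : lam ((t ^ (n - r)) (Ψ s)) = s r := by
  have hr : (r : ℕ) ≤ n := Fin.is_le r
  rw [hΨ, map_sum, map_sum, Finset.sum_eq_single r]
  · rw [← Module.End.mul_apply, ← pow_add, Nat.sub_add_cancel hr, hlam1]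
  · intro r' _ hr'
    rw [← Module.End.mul_apply, ← pow_add]
    refine hlam2 (p + (n - r + r')) ?_ _ (pow_apply_mem_gr gr t ht (he _) _)
    intro h
    apply hr'
    apply Fin.ext
    omega
  · intro h; exact absurd (Finset.mem_univ r) h

/-- **Splitting of strings born in an empty degree** (the key lemma).  Let `M = ⨁ₖ gr k` be a
graded semisimple module with `t` of degree `+1`, `S` simple, `e : S → gr p` with `tⁿ e ≠ 0`,
and suppose `S` does not occur in degree `p - 1`.  Then the string
`Z = ∑_{r ≤ n} tʳ e(S)` (the range of the string-sum map `Ψ`) has a `t`-stable complement `C`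
which is graded in the strong sense that every `x ∈ gr k` is `tʳ e s₀ + y` with `y ∈ C ∩ gr k`
(and `s₀ = 0` unless `k = p + r`); moreover `Ψ` is injective, `Z ≅ S^{n+1}`.
(Module-theoretic form of "a segment beginning at the bottom of its line splits off";
cf. Zelevinsky segments.) [folklore] -/
theorem exists_isCompl_stringSum (gr : ℕ → Submodule R M) (hind : iSupIndep gr)
    (hsup : ⨆ k, gr k = ⊤) (t : M →ₗ[R] M) (ht : ∀ k, ∀ x ∈ gr k, t x ∈ gr (k + 1))
    {S : Type*} [AddCommGroup S] [Module R S] [IsSimpleModule R S]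
    (e : S →ₗ[R] M) {p n : ℕ} (he : ∀ s, e s ∈ gr p)
    (hn : (t ^ n) ∘ₗ e ≠ 0)
    (hbelow : ∀ k, k + 1 = p → ∀ u : S →ₗ[R] M, (∀ s, u s ∈ gr k) → u = 0)
    (Ψ : (Fin (n + 1) → S) →ₗ[R] M)
    (hΨ : ∀ s, Ψ s = ∑ r : Fin (n + 1), (t ^ (r : ℕ)) (e (s r))) :
    Function.Injective Ψ ∧
    ∃ C : Submodule R M, IsCompl (LinearMap.range Ψ) C ∧ (∀ x ∈ C, t x ∈ C) ∧
      ∀ k, ∀ x ∈ gr k, ∃ (r : Fin (n + 1)) (s₀ : S), ∃ y ∈ C,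
        y ∈ gr k ∧ (s₀ ≠ 0 → p + r = k) ∧ x = Ψ (Pi.single r s₀) + y := by
  classical
  -- the top of the string, a simple submodule of degree `d = p + n`
  set d := p + n with hd
  have hinj_e : Function.Injective ((t ^ n) ∘ₗ e) := by
    refine LinearMap.injective_of_ne_zero fun h0 => hn ?_
    rw [h0]
  set Zd : Submodule R M := LinearMap.range ((t ^ n) ∘ₗ e) with hZd
  have hZd_le : Zd ≤ gr d := by
    rintro _ ⟨s, rfl⟩
    exact pow_apply_mem_gr gr t ht (he s) n
  let θ : S ≃ₗ[R] Zd := LinearEquiv.ofInjective _ hinj_e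
  haveI : IsSimpleModule R Zd := IsSimpleModule.congr θ.symm
  -- the image of the degree below the string under `t^(n+1)`, and the other degrees
  set Gb : Submodule R M := ⨆ (k) (_ : k + 1 = p), gr k with hGb
  set B : Submodule R M := Gb.map (t ^ (n + 1)) with hB
  set G' : Submodule R M := ⨆ (k) (_ : k ≠ d), gr k with hG'
  have hGb_le : ∀ x ∈ Gb, (t ^ (n + 1)) x ∈ gr d := by
    intro x hx
    obtain _ | p := p
    · have : Gb = ⊥ := by
        rw [hGb, iSup_eq_bot]; intro k; rw [iSup_eq_bot]; intro hk; omega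
      rw [this, Submodule.mem_bot] at hx
      rw [hx, map_zero]; exact zero_mem _
    · have : Gb = gr p := by
        rw [hGb]; apply le_antisymm
        · refine iSup_le fun k => iSup_le fun hk => ?_
          obtain rfl : k = p := by omega
          exact le_rfl
        · exact le_iSup_of_le p (le_iSup_of_le rfl le_rfl)
      rw [this] at hx
      have h1 := pow_apply_mem_gr gr t ht hx (n + 1)
      rw [hd, show p + 1 + n = p + (n + 1) by ring]
      exact h1
  have hB_le : B ≤ gr d := by
    rintro _ ⟨x, hx, rfl⟩; exact hGb_le x hx
  have hgr_le_Gb : ∀ k, k + 1 = p → gr k ≤ Gb := fun k hk => le_iSup_of_le k (le_iSup_of_le hk le_rfl)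
  have hGbS : ∀ u : S →ₗ[R] M, (∀ s, u s ∈ Gb) → u = 0 := by
    intro u hu
    obtain _ | p := p
    · have hGb0 : Gb = ⊥ := by
        rw [hGb, iSup_eq_bot]; intro k; rw [iSup_eq_bot]; intro hk; omega
      ext s
      have hs := hu s
      rw [hGb0, Submodule.mem_bot] at hs
      rw [hs, LinearMap.zero_apply]
    · have hGb' : Gb ≤ gr p := by
        refine iSup_le fun k => iSup_le fun hk => ?_
        obtain rfl : k = p := by omega
        exact le_rfl
      exact hbelow p rfl u fun s => hGb' (hu s)
  -- `Zd ⊓ B = ⊥`: otherwise `S ≅ Zd ≤ B = t^(n+1) Gb` lifts to a non-zero map `S → Gb`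
  have hZdB : Disjoint Zd B := by
    rw [disjoint_iff]
    by_contra hne
    have hle : Zd ≤ B := by
      have hat := (isSimpleModule_iff_isAtom.mp (inferInstance : IsSimpleModule R Zd))
      rcases hat.le_iff.mp (inf_le_left : Zd ⊓ B ≤ Zd) with h | h
      · exact absurd h hne
      · exact (inf_eq_left.mp h)
    -- the surjection `Gb → B`
    let π : Gb →ₗ[R] B := ((t ^ (n + 1)).domRestrict Gb).codRestrict B
      (fun x => ⟨x, x.2, rfl⟩)
    have hπ : Function.Surjective π := by
      rintro ⟨_, x, hx, rfl⟩; exact ⟨⟨x, hx⟩, rfl⟩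
    let j : S →ₗ[R] B := (Submodule.inclusion hle) ∘ₗ θ.toLinearMap
    obtain ⟨h, hh⟩ := IsSemisimpleModule.lifting_property π hπ j
    have hzero := hGbS (Gb.subtype ∘ₗ h) fun s => (h s).2
    haveI := IsSimpleModule.nontrivial R S
    obtain ⟨s, hs⟩ := exists_ne (0 : S)
    apply hs
    apply θ.injective
    rw [map_zero]
    apply Submodule.inclusion_injective hle
    rw [map_zero]
    change j s = 0
    rw [← hh, LinearMap.comp_apply]
    have : (h s : M) = 0 := congr($hzero s)
    have h2 : h s = 0 := Subtype.ext this
    rw [h2, map_zero]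
  have hdG' : Disjoint (gr d) G' := (iSupIndep_def.mp hind) d
  -- `Y = B ⊔ G'` is disjoint from `Zd`
  set Y : Submodule R M := B ⊔ G' with hY
  have hZdY : Disjoint Zd Y := by
    rw [Submodule.disjoint_def]
    intro z hz hzY
    obtain ⟨b, hb, g, hg, rfl⟩ := Submodule.mem_sup.mp hzY
    have hg0 : g = 0 := by
      refine (Submodule.disjoint_def.mp hdG') g ?_ hg
      have : b + g - b ∈ gr d := sub_mem (hZd_le hz) (hB_le hb)
      simpa using this
    subst hg0
    rw [add_zero] at hz ⊢
    exact (Submodule.disjoint_def.mp hZdB) b hz hb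
  obtain ⟨Q, hQ⟩ := exists_isCompl (Zd ⊔ Y)
  have hcompl : IsCompl Zd (Y ⊔ Q) := by
    refine ⟨?_, ?_⟩
    · rw [Submodule.disjoint_def]
      intro z hz hzYQ
      obtain ⟨y, hy, q, hq, rfl⟩ := Submodule.mem_sup.mp hzYQ
      have hq0 : q = 0 := by
        refine (Submodule.disjoint_def.mp hQ.disjoint) q ?_ hq
        have : y + q - y ∈ Zd ⊔ Y := sub_mem (Submodule.mem_sup_left hz) (Submodule.mem_sup_right hy)
        simpa using this
      subst hq0
      rw [add_zero] at hz ⊢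
      exact (Submodule.disjoint_def.mp hZdY) y hz hy
    · rw [codisjoint_iff, eq_top_iff]
      have := hQ.codisjoint; rw [codisjoint_iff] at this
      rw [← this]
      exact sup_le (sup_le le_sup_left (le_sup_of_le_right le_sup_left))
        (le_sup_of_le_right le_sup_right)
  -- the retraction `λ`
  let lam : M →ₗ[R] S := θ.symm.toLinearMap ∘ₗ Submodule.projectionOnto Zd (Y ⊔ Q) hcompl
  have hlam1 : ∀ s, lam ((t ^ n) (e s)) = s := by
    intro s
    have h1 : ((t ^ n) (e s) : M) = (θ s : Zd) := by
      rw [LinearEquiv.ofInjective_apply]; rfl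
    change θ.symm (Submodule.projectionOnto Zd (Y ⊔ Q) hcompl ((t ^ n) (e s))) = s
    rw [h1, Submodule.projectionOnto_apply_left, LinearEquiv.symm_apply_apply]
  have hlam_of_mem : ∀ x ∈ Y ⊔ Q, lam x = 0 := by
    intro x hx
    change θ.symm (Submodule.projectionOnto Zd (Y ⊔ Q) hcompl x) = 0
    rw [(Submodule.projectionOnto_apply_eq_zero_iff hcompl).mpr hx, map_zero]
  have hlam2 : ∀ k, k ≠ d → ∀ x ∈ gr k, lam x = 0 := by
    intro k hk x hx
    apply hlam_of_mem
    refine Submodule.mem_sup_left (Submodule.mem_sup_right ?_)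
    exact (le_iSup_of_le k (le_iSup_of_le hk le_rfl) : gr k ≤ G') hx
  have hlam3 : ∀ k, k + 1 = p → ∀ x ∈ gr k, lam ((t ^ (n + 1)) x) = 0 := by
    intro k hk x hx
    apply hlam_of_mem
    refine Submodule.mem_sup_left (Submodule.mem_sup_left ?_)
    exact ⟨x, hgr_le_Gb k hk hx, rfl⟩
  -- coordinates
  have hcoord : ∀ (s : Fin (n + 1) → S) (r : Fin (n + 1)), lam ((t ^ (n - r)) (Ψ s)) = s r :=
    coord_eq_of_stringSum gr t ht e he lam hlam1 hlam2 Ψ hΨ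
  have hΨinj : Function.Injective Ψ := by
    intro s s' h
    ext r
    rw [← hcoord s r, ← hcoord s' r, h]
  refine ⟨hΨinj, ?_⟩
  -- the complement
  let C : Submodule R M := ⨅ j : ℕ, LinearMap.ker (lam ∘ₗ (t ^ j))
  have hCmem : ∀ x, x ∈ C ↔ ∀ j, lam ((t ^ j) x) = 0 := by
    intro x; simp [C]
  have hCt : ∀ x ∈ C, t x ∈ C := by
    intro x hx
    rw [hCmem] at hx ⊢
    intro j
    rw [← Module.End.mul_apply, ← pow_succ]
    exact hx (j + 1)
  -- degreewise splitting
  have hsplit : ∀ k, ∀ x ∈ gr k, ∃ (r : Fin (n + 1)) (s₀ : S), ∃ y ∈ C,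
      y ∈ gr k ∧ (s₀ ≠ 0 → p + r = k) ∧ x = Ψ (Pi.single r s₀) + y := by
    intro k x hx
    by_cases hk : p ≤ k ∧ k ≤ p + n
    · obtain ⟨hk1, hk2⟩ := hk
      let r : Fin (n + 1) := ⟨k - p, by omega⟩
      have hr : (r : ℕ) = k - p := rfl
      set s₀ : S := lam ((t ^ (n - r)) x) with hs₀
      have hz : Ψ (Pi.single r s₀) = (t ^ (r : ℕ)) (e s₀) := by
        have := stringSum_single t e 0 Ψ (by simpa using hΨ) r s₀
        simpa using this
      have hzmem : Ψ (Pi.single r s₀) ∈ gr k := by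
        rw [hz]
        have := pow_apply_mem_gr gr t ht (he s₀) r
        rwa [hr, Nat.add_sub_cancel' hk1] at this
      refine ⟨r, s₀, x - Ψ (Pi.single r s₀), ?_, sub_mem hx hzmem, fun _ => by rw [hr]; omega,
        by abel⟩
      rw [hCmem]
      intro j
      rw [map_sub, map_sub]
      by_cases hj : k + j = d
      · have hj' : j = n - r := by rw [hr]; omega
        subst hj'
        rw [hz, ← Module.End.mul_apply, ← pow_add, Nat.sub_add_cancel (by rw [hr]; omega),
          hlam1, sub_self]
      · rw [hlam2 (k + j) hj _ (pow_apply_mem_gr gr t ht hx j),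
          hlam2 (k + j) hj _ (pow_apply_mem_gr gr t ht hzmem j), sub_self]
    · refine ⟨0, 0, x, ?_, hx, fun h => absurd rfl h, by simp⟩
      rw [hCmem]
      intro j
      by_cases hj : k + j = d
      · -- then `k < p` and `t^j x = t^(n+1) (t^(j-n-1) x)` with `t^(j-n-1) x ∈ gr (p-1)`
        have hkp : k < p := by omega
        have hj' : j = (n + 1) + (j - (n + 1)) := by omega
        rw [hj', pow_add, Module.End.mul_apply]
        refine hlam3 (k + (j - (n + 1))) (by omega) _ (pow_apply_mem_gr gr t ht hx _)
      · exact hlam2 (k + j) hj _ (pow_apply_mem_gr gr t ht hx j)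
  refine ⟨C, ⟨?_, ?_⟩, hCt, hsplit⟩
  · -- disjoint
    rw [Submodule.disjoint_def]
    rintro _ ⟨s, rfl⟩ hs
    rw [hCmem] at hs
    have : s = 0 := by
      ext r
      rw [← hcoord s r, hs]; rfl
    rw [this, map_zero]
  · -- codisjoint
    rw [codisjoint_iff, eq_top_iff, ← hsup]
    refine iSup_le fun k => fun x hx => ?_
    obtain ⟨r, s₀, y, hyC, -, -, rfl⟩ := hsplit k x hx
    exact add_mem (Submodule.mem_sup_left ⟨_, rfl⟩) (Submodule.mem_sup_right hyC)

end Splitting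

end Literature.RepresentationTheory.Semisimple
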